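import Literature.Probability.Percolation.CLE6Limit
import Literature.Probability.Percolation.CLE6Rerooting
import Literature.Probability.Percolation.LoopRebasing
import Literature.Probability.Percolation.InterfaceLoopPolygon
import HarnessLib

/-!
# Scaling limits of the percolation loop collections are reroot-saturated (unrooted loops)

Topic `Literature/Probability/Percolation`, companion to `CLE6.lean`, `CLE6Limit.lean`,
`CLE6Rerooting.lean` (proofs only: no new named facts; auxiliary definitions `Curve.rerootTime`,
`loopPts`, `SimpleGraph.Walk.rotateAt`). The unrooted Camia–Newman statement
`exists_isCNLFamily_tendsto` (F. Camia, C. M. Newman, MSRI Publ. 55 (2008), Thms 2–3; Comm.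
Math. Phys. 268 (2006), §2.2: loops are curves modulo reparametrisation *of the circle*) requires
of the limit law `ν D` that its samples be *reroot-saturated* closed sets of loops
(`IsCNLFamily.ae_rerootSaturation_eq`: `LoopSpace.rerootSaturation L = L`, i.e. the collection
contains every rerooting of each of its loops — the encoding of "unrooted loops" inside the
rooted Aizenman–Burchard space, see the audit section of `CLE6.lean`). This file proves that
property for **every** law that is a limit in law of the loop collections `triLoopCollection D δ`,
so that the hypothesis `hsat` of the reduction `exists_isCNLFamily_tendsto_of_tendstoLaw`
(`CLE6Limit.lean`) is discharged (`exists_isCNLFamily_tendsto_of_tendstoLaw'`). The argument is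
the lattice one implicit in CMP 268 (2006), §2 and §4 (a lattice loop enters the collection once
per base vertex, and every rerooting of a polygon is within one edge of a vertex-rebasing):

* `Curve.reparamDist_reroot_shift`, `Curve.mk_reroot_eq_mk_shift` — the rerooting
  `Curve.reroot` of `CLE6.lean` (built from `Path.truncate`/`Path.trans`: pause, second part at
  double speed, first part at double speed, pause) and the change of base point `Curve.shift` of
  `UnbasedLoops.lean` (`t ↦ γ (t + s mod 1)`) are two monotone traversals of the same circle map,
  hence define the same curve class (`Curve.reparamDist_eq_zero_of_monotone`); consequently the
  unbased distance `CurveClass.loopDist` does not see rerooting (`loopDist_mk_reroot`).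
* `siteLoopCurve_eq_closedPolygon`, `SimpleGraph.Walk.rotateAt`, `IsSiteInterfaceLoop.rotateAt`,
  `loopPts_rotateAt` — the class `siteLoopCurve δ w` of an interface loop is the closed polygon
  (`closedPolygon`, `LoopRebasing.lean`) through its embedded vertices `loopPts δ w`, its edges
  have length `≤ 2δ` (`IsSiteInterfaceLoop.edgesLE_loopPts`), and the polygon through the rotated
  vertex list is the class of the rotated walk `w.rotateAt k`, again an interface loop of the same
  configuration — so **all vertex-rebasings of a member of `triLoopCollection D δ ω` are members**.
* `exists_mem_triLoopCollection_dist_mk_reroot_le`, `edist_rerootSaturation_triLoopCollection_le`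
  — by the rebasing theorem `exists_rotate_dist_le` (an almost optimal change of base point can
  be moved to the preceding vertex at cost `≤` one edge), every rerooting of every representative
  of every member of `L_δ = triLoopCollection D δ ω` is within `2δ` (plus any `θ > 0`) of a member;
  hence `edist (rerootSaturation L_δ) L_δ ≤ 2δ` in the Hausdorff extended distance, for every
  configuration `ω` and every `δ > 0`.
* `isClosed_setOf_isLoop_and_edist_rerootSaturation_le` — "all members are loops and
  `edist (rerootSaturation L) L ≤ η`" is a closed condition (`rerootSaturation` is `1`-Lipschitz
  on loop collections, `CLE6Rerooting.lean`).
* `ae_rerootSaturation_eq_of_tendstoLaw` — portmanteau (`TendstoLaw.ae_mem_of_isClosed`): every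
  limit law `P'` of the loop collections is carried, for every `η > 0`, by that closed set, hence
  by reroot-saturated collections; `exists_isCNLFamily_tendsto_of_tendstoLaw'` records the
  resulting reduction of `exists_isCNLFamily_tendsto` to existence of the limit, local finiteness
  of traces, infinitude of traces and conformal invariance.

## References

* F. Camia, C. M. Newman, Comm. Math. Phys. 268 (2006) 1–38, §2.2 (the space of unrooted loops),
  §4 (lattice loops) [CamiaNewman2006].
* F. Camia, C. M. Newman, MSRI Publ. 55 (2008), Thms 2–3 [CamiaNewman2008].
* M. Aizenman, A. Burchard, Duke Math. J. 99 (1999), §2.1 [AizenmanBurchardDuke1999].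
* P. Billingsley, *Convergence of probability measures*, 2nd ed. (1999), Thm 2.1 [Billingsley1999].
-/

noncomputable section

open Set Filter Metric MeasureTheory
open scoped ENNReal NNReal Topology unitInterval

/-! ### Rerooting is a change of base point, modulo reparametrisation -/

namespace Literature.Probability.RandomPlanarGeometry

namespace Curve

variable {E : Type*} [PseudoMetricSpace E]

/-- The time change turning the change of base point `γ.shift s` into the rerooting
`γ.reroot s`: on `[0, 1/2]` it is `u ↦ clamp (2u; s, 1) - s`, on `[1/2, 1]` it is
`u ↦ 1 - s + clamp (2u - 1; 0, s)` (continuous, monotone, from `0` to `1` when `s ∈ [0, 1]`)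
(Camia–Newman 2006, §2.2: loops modulo reparametrisation of the circle). [folklore] -/
def rerootTime (s : ℝ) (u : ℝ) : ℝ :=
  if u ≤ 1 / 2 then min (max (2 * u) s) 1 - s else 1 - s + min (max (2 * u - 1) 0) s

/-- First branch of `rerootTime`. [folklore] -/
theorem rerootTime_of_le {s u : ℝ} (hu : u ≤ 1 / 2) :
    rerootTime s u = min (max (2 * u) s) 1 - s := if_pos hu

/-- Second branch of `rerootTime`. [folklore] -/
theorem rerootTime_of_not_le {s u : ℝ} (hu : ¬ u ≤ 1 / 2) :
    rerootTime s u = 1 - s + min (max (2 * u - 1) 0) s := if_neg hu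

/-- `rerootTime s` is continuous (the two branches agree at `u = 1/2`). [folklore] -/
theorem continuous_rerootTime {s : ℝ} (hs0 : 0 ≤ s) (hs1 : s ≤ 1) : Continuous (rerootTime s) := by
  have hc1 : Continuous fun u : ℝ ↦ min (max (2 * u) s) 1 - s :=
    (((continuous_const.mul continuous_id).max continuous_const).min continuous_const).sub
      continuous_const
  have hc2 : Continuous fun u : ℝ ↦ 1 - s + min (max (2 * u - 1) 0) s :=
    continuous_const.add
      ((((continuous_const.mul continuous_id).sub continuous_const).max continuous_const).min
        continuous_const)
  refine Continuous.if_le hc1 hc2 continuous_id continuous_const ?_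
  rintro u rfl
  have h1 : max (2 * (1 / 2 : ℝ)) s = 1 := by
    rw [show (2 : ℝ) * (1 / 2) = 1 by norm_num]; exact max_eq_left hs1
  have h2 : max (2 * (1 / 2 : ℝ) - 1) 0 = 0 := by norm_num
  rw [h1, h2, min_self, min_eq_left hs0]
  ring

/-- `rerootTime s` is monotone. [folklore] -/
theorem monotone_rerootTime {s : ℝ} (hs0 : 0 ≤ s) : Monotone (rerootTime s) := by
  intro a b hab
  by_cases ha : a ≤ 1 / 2 <;> by_cases hb : b ≤ 1 / 2
  · rw [rerootTime_of_le ha, rerootTime_of_le hb]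
    have : min (max (2 * a) s) 1 ≤ min (max (2 * b) s) 1 :=
      min_le_min_right _ (max_le_max_right _ (by linarith))
    linarith
  · rw [rerootTime_of_le ha, rerootTime_of_not_le hb]
    have h1 : min (max (2 * a) s) 1 ≤ 1 := min_le_right _ _
    have h2 : 0 ≤ min (max (2 * b - 1) 0) s := le_min (le_max_right _ _) hs0
    linarith
  · exact absurd (hab.trans hb) ha
  · rw [rerootTime_of_not_le ha, rerootTime_of_not_le hb]
    have : min (max (2 * a - 1) 0) s ≤ min (max (2 * b - 1) 0) s :=
      min_le_min_right _ (max_le_max_right _ (by linarith))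
    linarith

/-- `rerootTime s 0 = 0`. [folklore] -/
theorem rerootTime_zero {s : ℝ} (hs0 : 0 ≤ s) (hs1 : s ≤ 1) : rerootTime s 0 = 0 := by
  rw [rerootTime_of_le (by norm_num), mul_zero, max_eq_right hs0, min_eq_left hs1, sub_self]

/-- `rerootTime s 1 = 1`. [folklore] -/
theorem rerootTime_one {s : ℝ} (hs1 : s ≤ 1) : rerootTime s 1 = 1 := by
  rw [rerootTime_of_not_le (by norm_num), show (2 : ℝ) * 1 - 1 = 1 by norm_num,
    max_eq_left zero_le_one, min_eq_right hs1]
  ring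

/-- **Rerooting is the change of base point followed by a monotone time change**: for a loop
`γ` and `s ∈ [0, 1]`, `γ.reroot s u = γ.loopMap (rerootTime s u + s)` (both halves of
`Curve.reroot_apply` read through the circle map; at the seam `γ 1 = γ 0`)
(Camia–Newman 2006, §2.2). [folklore] -/
theorem reroot_apply_eq_loopMap {γ : Curve E} (hγ : γ.IsLoop) (s u : I) :
    γ.reroot s u = γ.loopMap (((rerootTime s u + s : ℝ)) : AddCircle (1 : ℝ)) := by
  rw [loopMap_coe_eq, reroot_apply hγ]
  have hs0 : (0 : ℝ) ≤ s := s.2.1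
  have hs1 : (s : ℝ) ≤ 1 := s.2.2
  split_ifs with hu
  · -- first half: the point `γ (clamp (2u; s, 1))`
    set x : ℝ := min (max (2 * (u : ℝ)) s) 1 with hx
    have hx01 : x ∈ Icc (0 : ℝ) 1 := ⟨le_min (hs0.trans (le_max_right _ _)) zero_le_one, min_le_right _ _⟩
    have hsum : rerootTime s u + s = x := by rw [rerootTime_of_le hu]; ring
    change γ.toPath.extend x = _
    rw [Literature.Probability.Percolation.toPath_extend_apply, projIcc_of_mem _ hx01]
    refine apply_eq_of_fract_eq hγ ?_
    simp only [hsum, Int.fract_fract]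
  · -- second half: the point `γ (clamp (2u - 1; 0, s))`, one lap later
    set y : ℝ := min (max (2 * (u : ℝ) - 1) 0) s with hy
    have hy01 : y ∈ Icc (0 : ℝ) 1 := ⟨le_min (le_max_right _ _) hs0, (min_le_right _ _).trans hs1⟩
    have hsum : rerootTime s u + s = y + 1 := by rw [rerootTime_of_not_le hu]; ring
    change γ.toPath.extend y = _
    rw [Literature.Probability.Percolation.toPath_extend_apply, projIcc_of_mem _ hy01]
    refine apply_eq_of_fract_eq hγ ?_
    simp only [hsum, Int.fract_add_one, Int.fract_fract]

/-- **`Curve.reroot` and `Curve.shift` are at reparametrisation distance `0`**: two monotone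
continuous traversals of the same circle map (`Curve.reparamDist_eq_zero_of_monotone` with the
time changes `rerootTime s` and `id`) (Camia–Newman 2006, §2.2; Aizenman–Burchard 1999, §2.1).
[folklore] -/
theorem reparamDist_reroot_shift {γ : Curve E} (hγ : γ.IsLoop) (s : I) :
    reparamDist (γ.reroot s) (γ.shift s) = 0 := by
  have hs0 : (0 : ℝ) ≤ s := s.2.1
  have hs1 : (s : ℝ) ≤ 1 := s.2.2
  refine reparamDist_eq_zero_of_monotone (m := 1) zero_le_one
    (V := fun x : ℝ ↦ γ.loopMap (((x + s : ℝ)) : AddCircle (1 : ℝ)))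
    ((continuous_loopMap hγ).comp (by fun_prop)).continuousOn
    (h₁ := rerootTime s) (h₂ := id) (continuous_rerootTime hs0 hs1) continuous_id
    (monotone_rerootTime hs0) monotone_id (rerootTime_zero hs0 hs1) rfl (rerootTime_one hs1) rfl
    (fun u ↦ reroot_apply_eq_loopMap hγ s u) fun u ↦ ?_
  rw [shift_apply hγ]
  rfl

/-- **Rerooting a loop at `s` and changing its base point to `s` give the same curve class**
(Camia–Newman 2006, §2.2: unrooted loops). [folklore] -/
theorem mk_reroot_eq_mk_shift {γ : Curve E} (hγ : γ.IsLoop) (s : I) :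
    CurveClass.mk (γ.reroot s) = CurveClass.mk (γ.shift s) :=
  CurveClass.mk_eq_mk.2 (reparamDist_reroot_shift hγ s)

/-- The unbased distance from a rerooted loop: `loopDist (γ.reroot s) β = loopDist γ β` for loops
`γ`, `β` (`loopDist` is blind to the base point of either loop) (DKKMO, arXiv:2012.11672, eq. (1);
Camia–Newman 2006, §2.2). [folklore] -/
theorem loopDist_reroot_left {γ β : Curve E} (hγ : γ.IsLoop) (hβ : β.IsLoop) (s : I) :
    loopDist (γ.reroot s) β = loopDist γ β := by
  rw [loopDist_eq_of_reparamDist_eq_zero β (reparamDist_reroot_shift hγ s),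
    loopDist_shift_left hγ hβ]

end Curve

namespace CurveClass

variable {E : Type*} [MetricSpace E]

/-- On classes: the unbased distance from the class of a rerooted loop to a loop class is the
based-blind distance of the original classes, in particular at most their (based) distance
(Camia–Newman 2006, §2.2). [folklore] -/
theorem loopDist_mk_reroot_le_dist {γ : Curve E} (hγ : γ.IsLoop) {c : CurveClass E}
    (hc : c.IsLoop) (s : I) : loopDist (mk (γ.reroot s)) c ≤ dist (mk γ) c := by
  obtain ⟨β, rfl⟩ := surjective_mk c
  rw [loopDist_mk, Curve.loopDist_reroot_left hγ (isLoop_mk.1 hc) s, ← loopDist_mk]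
  exact loopDist_le_dist _ _

end CurveClass

end Literature.Probability.RandomPlanarGeometry

/-! ### Rotating a closed walk at its `k`-th vertex -/

namespace SimpleGraph.Walk

variable {V : Type*} {G : SimpleGraph V} {v : V}

/-- **Rotation of a closed walk at its `k`-th vertex**: the walk `v_k → … → v_n = v_0 → … → v_k`
obtained from `v_0 → v_1 → … → v_n = v_0` (`k ≤ n`), as `(w.drop k).append (w.take k)`. Unlike
Mathlib's `Walk.rotate` (rotation at the first visit of a given vertex) it is indexed by the
position, which is what the vertex-rebasing of lattice loops needs (a lattice loop of length
`n` enters the percolation loop collection through its `n` rotations; Camia–Newman, CMP 268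
(2006), §2 and §4). [folklore] -/
def rotateAt (w : G.Walk v v) (k : ℕ) : G.Walk (w.getVert k) (w.getVert k) :=
  (w.drop k).append (w.take k)

/-- The rotated walk has the same length. [folklore] -/
theorem length_rotateAt (w : G.Walk v v) {k : ℕ} (hk : k ≤ w.length) :
    (w.rotateAt k).length = w.length := by
  rw [rotateAt, length_append, drop_length, take_length, Nat.min_eq_left hk]
  omega

/-- The darts of the rotated walk are the rotated darts. [folklore] -/
theorem darts_rotateAt (w : G.Walk v v) {k : ℕ} (hk : k ≤ w.length) :
    (w.rotateAt k).darts = w.darts.rotate k := by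
  rw [rotateAt, darts_append, darts_drop, darts_take,
    List.rotate_eq_drop_append_take (by rwa [length_darts])]

/-- The edges of the rotated walk are the rotated edges. [folklore] -/
theorem edges_rotateAt (w : G.Walk v v) {k : ℕ} (hk : k ≤ w.length) :
    (w.rotateAt k).edges = w.edges.rotate k := by
  rw [rotateAt, edges_append, edges_drop, edges_take,
    List.rotate_eq_drop_append_take (by rwa [length_edges])]

/-- The support of the walk rotated at a positive position `j + 1 ≤ n`, in terms of the tail
`[v_1, …, v_n]` of the support: `[v_{j+1}, …, v_n] ++ [v_1, …, v_{j+1}]`. [folklore] -/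
theorem support_rotateAt_succ (w : G.Walk v v) {j : ℕ} (hj : j + 1 ≤ w.length) :
    (w.rotateAt (j + 1)).support = w.support.tail.drop j ++ w.support.tail.take (j + 1) := by
  rw [rotateAt, support_append, drop_support_eq_support_drop_min, Nat.min_eq_left hj, support_take,
    ← List.drop_tail]
  congr 1
  conv_lhs => rw [← w.cons_tail_support]
  rw [List.take_succ_cons, List.tail_cons]

/-- The tail of the support of the walk rotated at `j + 1 ≤ n` is the tail of the support
rotated by `j + 1`. [folklore] -/
theorem tail_support_rotateAt_succ (w : G.Walk v v) {j : ℕ} (hj : j + 1 ≤ w.length) :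
    (w.rotateAt (j + 1)).support.tail = w.support.tail.rotate (j + 1) := by
  have hlen : w.support.tail.length = w.length := by
    rw [List.length_tail, length_support]; rfl
  have hne : w.support.tail.drop j ≠ [] := by
    intro h
    have := congrArg List.length h
    rw [List.length_drop, hlen, List.length_nil] at this
    omega
  rw [support_rotateAt_succ w hj, List.tail_append_of_ne_nil hne, List.tail_drop,
    List.rotate_eq_drop_append_take (by rw [hlen]; exact hj)]

/-- The vertex list of the walk rotated at `j + 1 ≤ n`, without its repeated endpoint, is
the tail of the support rotated by `j`: `[v_{j+1}, …, v_n, v_1, …, v_j]`. [folklore] -/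
theorem dropLast_support_rotateAt_succ (w : G.Walk v v) {j : ℕ} (hj : j + 1 ≤ w.length) :
    (w.rotateAt (j + 1)).support.dropLast = w.support.tail.rotate j := by
  have hlen : w.support.tail.length = w.length := by
    rw [List.length_tail, length_support]; rfl
  have hne : w.support.tail.take (j + 1) ≠ [] := by
    intro h
    have := congrArg List.length h
    rw [List.length_take, hlen, List.length_nil] at this
    omega
  rw [support_rotateAt_succ w hj, List.dropLast_append_of_ne_nil hne, List.dropLast_eq_take,
    List.length_take, hlen, Nat.min_eq_left hj, Nat.add_sub_cancel, List.take_take,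
    Nat.min_eq_left (Nat.le_succ j), List.rotate_eq_drop_append_take (by rw [hlen]; omega)]

/-- For a closed walk, the support without its repeated endpoint, `[v_0, …, v_{n-1}]`, is the
tail `[v_1, …, v_n]` rotated by `n - 1` (as `v_n = v_0`). [folklore] -/
theorem dropLast_support_eq_rotate_tail (w : G.Walk v v) (hw : 0 < w.length) :
    w.support.dropLast = w.support.tail.rotate (w.length - 1) := by
  have hlen : w.support.tail.length = w.length := by
    rw [List.length_tail, length_support]; rfl
  have hne : w.support.tail ≠ [] := by
    intro h; rw [h, List.length_nil] at hlen; omega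
  have hlast : w.support.tail.getLast hne = v := by
    rw [List.getLast_tail]; exact w.getLast_support
  have h1 : w.support.dropLast = v :: w.support.tail.dropLast := by
    conv_lhs => rw [← w.cons_tail_support]
    rw [List.dropLast_cons_of_ne_nil hne]
  have h2 : w.support.tail = w.support.tail.dropLast ++ [v] := by
    conv_lhs => rw [← List.dropLast_concat_getLast hne, hlast]
  have h3 : w.support.tail.dropLast.length = w.length - 1 := by
    rw [List.length_dropLast, hlen]
  rw [h1, h2, List.dropLast_concat, ← h3, List.rotate_append_length_eq]
  rfl

/-- **Vertex lists of rotations**: for `1 ≤ k ≤ n`, the vertex list (support without the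
repeated endpoint) of the walk rotated at position `k` is the vertex list of the walk rotated by
`k`. [folklore] -/
theorem dropLast_support_rotateAt (w : G.Walk v v) {k : ℕ} (hk0 : 0 < k) (hk : k ≤ w.length) :
    (w.rotateAt k).support.dropLast = w.support.dropLast.rotate k := by
  have hlen : w.support.tail.length = w.length := by
    rw [List.length_tail, length_support]; rfl
  obtain ⟨j, rfl⟩ : ∃ j, k = j + 1 := ⟨k - 1, by omega⟩
  rw [dropLast_support_rotateAt_succ w hk, dropLast_support_eq_rotate_tail w (by omega),
    List.rotate_rotate]
  conv_rhs => rw [show w.length - 1 + (j + 1) = j + w.support.tail.length by rw [hlen]; omega,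
    ← List.rotate_rotate]
  rw [← List.length_rotate w.support.tail j, List.rotate_length]

/-- A rotation of a cycle is a cycle (same edges up to rotation, same tail of the support up to
rotation). [folklore] -/
theorem IsCycle.rotateAt {w : G.Walk v v} (hw : w.IsCycle) {k : ℕ} (hk0 : 0 < k) (hk : k ≤ w.length) :
    (w.rotateAt k).IsCycle := by
  obtain ⟨j, rfl⟩ : ∃ j, k = j + 1 := ⟨k - 1, by omega⟩
  rw [isCycle_def] at hw ⊢
  obtain ⟨htrail, -, hnodup⟩ := hw
  refine ⟨?_, ?_, ?_⟩
  · rw [isTrail_def] at htrail ⊢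
    rw [edges_rotateAt w hk]
    exact List.nodup_rotate.2 htrail
  · intro h
    have := congrArg Walk.length h
    rw [length_rotateAt w hk, length_nil] at this
    omega
  · rw [tail_support_rotateAt_succ w hk]
    exact List.nodup_rotate.2 hnodup

end SimpleGraph.Walk

/-! ### Interface loops are closed polygons; all their vertex-rebasings are interface loops -/

namespace Literature.Probability.Percolation

open RandomPlanarGeometry LatticeModels

section Lattice

variable {ω : SiteConfig (Site 2)} {f₀ : HexVertex}

/-- The embedded vertex list of a closed walk of the hexagonal lattice at mesh `δ`, without the
repeated endpoint: `[δ c(v_0), …, δ c(v_{n-1})]` for `w : v_0 → v_1 → … → v_n = v_0`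
(Camia–Newman, CMP 268 (2006), §2: lattice loops as polygonal curves). [folklore] -/
def loopPts (δ : ℝ) (w : hexGraph.Walk f₀ f₀) : List ℂ :=
  w.support.dropLast.map fun v ↦ (δ : ℂ) * hexCenter v

/-- `loopPts δ w` has `n = w.length` entries. [folklore] -/
theorem length_loopPts (δ : ℝ) (w : hexGraph.Walk f₀ f₀) : (loopPts δ w).length = w.length := by
  rw [loopPts, List.length_map, List.length_dropLast, SimpleGraph.Walk.length_support]
  rfl

/-- Closing up the vertex list gives back the embedded support:
`loopPts δ w ++ (loopPts δ w).take 1 = w.support.map (δ c(·))` (for a walk with at least one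
dart). [folklore] -/
theorem loopPts_append_take_one (δ : ℝ) (w : hexGraph.Walk f₀ f₀) (hw : 0 < w.length) :
    loopPts δ w ++ (loopPts δ w).take 1 = w.support.map fun v ↦ (δ : ℂ) * hexCenter v := by
  have hne : w.support.tail ≠ [] := by
    intro h
    have h1 := congrArg List.length h
    rw [List.length_tail, SimpleGraph.Walk.length_support, List.length_nil] at h1
    omega
  have h1 : w.support.dropLast = f₀ :: w.support.tail.dropLast := by
    conv_lhs => rw [← w.cons_tail_support]
    rw [List.dropLast_cons_of_ne_nil hne]
  have h2 : w.support.dropLast.take 1 = [f₀] := by rw [h1]; rfl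
  rw [loopPts, ← List.map_take, ← List.map_append, h2, w.dropLast_support_concat]

/-- **An interface loop enters the loop collection as the closed polygon through its vertices**:
`siteLoopCurve δ w = closedPolygon (loopPts δ w)` (`closedPolygon`, `LoopRebasing.lean`: the
class of the prelude's polyline through `pts ++ pts.take 1`) (Camia–Newman, CMP 268 (2006), §2).
[folklore] -/
theorem siteLoopCurve_eq_closedPolygon (δ : ℝ) (w : hexGraph.Walk f₀ f₀) (hw : 0 < w.length) :
    siteLoopCurve δ w = closedPolygon (loopPts δ w) := by
  rw [closedPolygon, loopPts_append_take_one δ w hw]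
  rfl

/-- The vertex list of the walk rotated at position `1 ≤ k ≤ n` is the rotated vertex list.
[folklore] -/
theorem loopPts_rotateAt (δ : ℝ) (w : hexGraph.Walk f₀ f₀) {k : ℕ} (hk0 : 0 < k) (hk : k ≤ w.length) :
    loopPts δ (w.rotateAt k) = (loopPts δ w).rotate k := by
  rw [loopPts, loopPts, SimpleGraph.Walk.dropLast_support_rotateAt w hk0 hk, List.map_rotate]

/-- **Rotations of an interface loop are interface loops** of the same configuration (same
darts, and a rotation of a cycle is a cycle): a lattice loop of length `n` enters
`triLoopCollection` through its `n` rotations (Camia–Newman, CMP 268 (2006), §2). [folklore] -/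
theorem IsSiteInterfaceLoop.rotateAt {w : hexGraph.Walk f₀ f₀} (hw : IsSiteInterfaceLoop ω w) {k : ℕ}
    (hk0 : 0 < k) (hk : k ≤ w.length) : IsSiteInterfaceLoop ω (w.rotateAt k) := by
  refine ⟨hw.isCycle.rotateAt hk0 hk, fun d hd ↦ hw.2 d ?_⟩
  rw [SimpleGraph.Walk.darts_rotateAt w hk] at hd
  exact List.mem_rotate.1 hd

/-- **The vertex-rebasings of an interface loop are in the loop collection**: for
`k < n = w.length`, the closed polygon through the rotated vertex list `(loopPts δ w).rotate k`
is the class `siteLoopCurve δ w'` of an interface loop `w'` of the same configuration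
(Camia–Newman, CMP 268 (2006), §2). [folklore] -/
theorem IsSiteInterfaceLoop.exists_siteLoopCurve_eq_closedPolygon_rotate {w : hexGraph.Walk f₀ f₀}
    (hw : IsSiteInterfaceLoop ω w) (δ : ℝ) {k : ℕ} (hk : k < w.length) :
    ∃ (f : HexVertex) (w' : hexGraph.Walk f f), IsSiteInterfaceLoop ω w' ∧
      closedPolygon ((loopPts δ w).rotate k) = siteLoopCurve δ w' := by
  have hlen : 0 < w.length := by have := hw.isCycle.three_le_length; omega
  rcases Nat.eq_zero_or_pos k with rfl | hk0
  · exact ⟨f₀, w, hw, by rw [List.rotate_zero, siteLoopCurve_eq_closedPolygon δ w hlen]⟩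
  · refine ⟨_, w.rotateAt k, hw.rotateAt hk0 hk.le, ?_⟩
    rw [siteLoopCurve_eq_closedPolygon δ _ (by rw [SimpleGraph.Walk.length_rotateAt w hk.le]; exact hlen),
      loopPts_rotateAt δ w hk0 hk.le]

/-- **The edges of an interface polygon at mesh `δ` have length `≤ 2δ`** (both ends of a dart
piece are within `δ` of the open site on its left, `dist_polyPt_leftPt_le`): the closed-up
vertex list `loopPts δ w ++ (loopPts δ w).take 1` has `(2δ)`-short edges (`EdgesLE`).
[folklore] -/
theorem IsSiteInterfaceLoop.edgesLE_loopPts {w : hexGraph.Walk f₀ f₀} (hw : IsSiteInterfaceLoop ω w)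
    {δ : ℝ} (hδ : 0 ≤ δ) : EdgesLE (2 * δ) (loopPts δ w ++ (loopPts δ w).take 1) := by
  have hlen : 0 < w.length := by have := hw.isCycle.three_le_length; omega
  rw [loopPts_append_take_one δ w hlen]
  refine List.isChain_iff_getElem.2 fun j hj ↦ ?_
  have hj' : j < w.length := by
    rw [List.length_map, SimpleGraph.Walk.length_support] at hj; omega
  simp only [List.getElem_map, SimpleGraph.Walk.support_getElem_eq_getVert]
  obtain ⟨h1, h2⟩ := hw.dist_polyPt_leftPt_le hδ hj'
  change dist (polyPt δ w j) (polyPt δ w (j + 1)) ≤ 2 * δ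
  rw [dist_comm] at h2
  linarith [dist_triangle (polyPt δ w j) (hw.leftPt δ j) (polyPt δ w (j + 1))]

end Lattice

/-! ### The loop collection at mesh `δ` is reroot-saturated up to `2δ` -/

section Hausdorff

variable (D : JordanDomain)

/-- **Every rerooting of a member of the loop collection is within `2δ` of a member.** Let
`c = mk γ ∈ triLoopCollection D δ ω` (`δ > 0`) and `s ∈ [0, 1]`. For every `θ > 0` there is a
member `c'` of the collection with `dist (mk (γ.reroot s)) c' ≤ 2δ + θ`: choose an interface
polygon `closedPolygon pts` within `θ/2` of `c` (the collection is the closure of the set of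
interface polygons); the unbased distance from `mk (γ.reroot s)` to it is then `< θ/2`
(`loopDist_mk_reroot_le_dist`), so by the rebasing theorem `exists_rotate_dist_le` some
vertex-rebasing `closedPolygon (pts.rotate k)` — a member
(`exists_siteLoopCurve_eq_closedPolygon_rotate`) — is within `θ/2 + 2δ + θ/2` in the based
distance (Camia–Newman, CMP 268 (2006), §2: lattice loops are unrooted). [folklore] -/
theorem exists_mem_triLoopCollection_dist_mk_reroot_le {δ : ℝ} (hδ : 0 < δ)
    (ω : SiteConfig (Site 2)) {γ : Curve ℂ} (hγ : CurveClass.mk γ ∈ triLoopCollection D δ ω)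
    (s : I) {θ : ℝ} (hθ : 0 < θ) :
    ∃ c ∈ triLoopCollection D δ ω, dist (CurveClass.mk (γ.reroot s)) c ≤ 2 * δ + θ := by
  have hγl : γ.IsLoop := CurveClass.isLoop_mk.1 (isLoop_of_mem_triLoopCollection hγ)
  have hcl : CurveClass.mk γ ∈ closure {c | ∃ (f : HexVertex) (w : hexGraph.Walk f f),
      IsSiteInterfaceLoop (ω ∩ triMeshVertices D.carrier δ) w ∧ c = siteLoopCurve δ w} := hγ
  obtain ⟨_, ⟨f, w, hw, rfl⟩, hdist⟩ := Metric.mem_closure_iff.1 hcl (θ / 2) (half_pos hθ)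
  have hlen : 0 < w.length := by have := hw.isCycle.three_le_length; omega
  have hn : loopPts δ w ≠ [] := by
    rw [← List.length_pos_iff, length_loopPts]; exact hlen
  obtain ⟨k, hk, hkd⟩ := exists_rotate_dist_le hn (hw.edgesLE_loopPts hδ.le)
    (CurveClass.mk (γ.reroot s)) (half_pos hθ)
  rw [length_loopPts] at hk
  obtain ⟨f', w', hw', heq⟩ := hw.exists_siteLoopCurve_eq_closedPolygon_rotate δ hk
  refine ⟨closedPolygon ((loopPts δ w).rotate k), ?_, ?_⟩
  · rw [heq]; exact siteLoopCurve_mem_triLoopCollection hw'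
  · have h1 : CurveClass.loopDist (CurveClass.mk (γ.reroot s)) (closedPolygon (loopPts δ w)) ≤
        dist (CurveClass.mk γ) (closedPolygon (loopPts δ w)) :=
      CurveClass.loopDist_mk_reroot_le_dist hγl (isLoop_closedPolygon _) s
    rw [← siteLoopCurve_eq_closedPolygon δ w hlen] at h1 hkd
    linarith [hdist.le]

/-- **The loop collection at mesh `δ > 0` is reroot-saturated up to `2δ`**: for every
configuration `ω`, `edist (rerootSaturation L_δ) L_δ ≤ 2δ` in the Hausdorff extended distance
of the Aizenman–Burchard space, `L_δ = triLoopCollection D δ ω` (every generator of the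
reroot-saturation is within `2δ` of `L_δ`, `exists_mem_triLoopCollection_dist_mk_reroot_le`, and
`L_δ ⊆ rerootSaturation L_δ`) (Camia–Newman, CMP 268 (2006), §2). [folklore] -/
theorem edist_rerootSaturation_triLoopCollection_le {δ : ℝ} (hδ : 0 < δ) (ω : SiteConfig (Site 2)) :
    edist (LoopSpace.rerootSaturation (triLoopCollection D δ ω)) (triLoopCollection D δ ω) ≤
      ENNReal.ofReal (2 * δ) := by
  set L := triLoopCollection D δ ω with hL
  rw [TopologicalSpace.Closeds.edist_eq]
  change hausdorffEDist (closure _) _ ≤ _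
  rw [hausdorffEDist_closure_left]
  refine hausdorffEDist_le_of_infEDist ?_ ?_
  · rintro _ ⟨γ, s, hγ, rfl⟩
    refine ENNReal.le_of_forall_pos_le_add fun θ hθ _ ↦ ?_
    obtain ⟨c, hc, hle⟩ := exists_mem_triLoopCollection_dist_mk_reroot_le D hδ ω hγ s
      (θ := θ) (by exact_mod_cast hθ)
    calc infEDist (CurveClass.mk (γ.reroot s)) (L : Set (CurveClass ℂ))
        ≤ edist (CurveClass.mk (γ.reroot s)) c := infEDist_le_edist_of_mem hc
      _ = ENNReal.ofReal (dist (CurveClass.mk (γ.reroot s)) c) := edist_dist _ _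
      _ ≤ ENNReal.ofReal (2 * δ + θ) := ENNReal.ofReal_le_ofReal hle
      _ = ENNReal.ofReal (2 * δ) + θ := by
          rw [ENNReal.ofReal_add (by positivity) (by positivity), ENNReal.ofReal_coe_nnreal]
  · intro x hx
    obtain ⟨γ, rfl⟩ := CurveClass.surjective_mk x
    have hmem : CurveClass.mk γ ∈ {c | ∃ (γ' : Curve ℂ) (s : unitInterval),
        CurveClass.mk γ' ∈ L ∧ c = CurveClass.mk (γ'.reroot s)} :=
      ⟨γ, 0, hx, (Curve.mk_reroot_zero γ).symm⟩
    rw [infEDist_zero_of_mem hmem]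
    exact bot_le

end Hausdorff

/-! ### Passing to the limit -/

section Limit

/-- "All members are loops and the collection is reroot-saturated up to `η`" is a closed
condition on the Aizenman–Burchard space: loop collections form a closed set
(`isClosed_setOf_forall_isLoop`) on which `rerootSaturation` is continuous (`1`-Lipschitz,
`continuousOn_rerootSaturation`), and `edist` is continuous. [folklore] -/
theorem isClosed_setOf_isLoop_and_edist_rerootSaturation_le (η : ℝ≥0∞) :
    IsClosed {L : LoopSpace ℂ | (∀ c ∈ L, CurveClass.IsLoop c) ∧
      edist (LoopSpace.rerootSaturation L) L ≤ η} := by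
  have hS : IsClosed {L : LoopSpace ℂ | ∀ c ∈ L, CurveClass.IsLoop c} := isClosed_setOf_forall_isLoop
  have hf : ContinuousOn (fun L : LoopSpace ℂ ↦ edist (LoopSpace.rerootSaturation L) L)
      {L : LoopSpace ℂ | ∀ c ∈ L, CurveClass.IsLoop c} :=
    continuous_edist.comp_continuousOn (continuousOn_rerootSaturation.prodMk continuousOn_id)
  exact hf.preimage_isClosed_of_isClosed hS isClosed_Iic

variable (D : JordanDomain)

/-- For `0 < δ ≤ η / 2` the loop collection at mesh `δ` lies (surely) in the closed set of loop
collections reroot-saturated up to `η`. [folklore] -/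
theorem triLoopCollection_mem_setOf_edist_rerootSaturation_le {η δ : ℝ} (hδ : 0 < δ) (hδη : δ ≤ η / 2)
    (ω : SiteConfig (Site 2)) :
    triLoopCollection D δ ω ∈ {L : LoopSpace ℂ | (∀ c ∈ L, CurveClass.IsLoop c) ∧
      edist (LoopSpace.rerootSaturation L) L ≤ ENNReal.ofReal η} :=
  ⟨fun _ hc ↦ isLoop_of_mem_triLoopCollection hc,
    (edist_rerootSaturation_triLoopCollection_le D hδ ω).trans (ENNReal.ofReal_le_ofReal (by linarith))⟩

/-- **Scaling limits of the loop collections are reroot-saturated** (the field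
`IsCNLFamily.ae_rerootSaturation_eq` for any limit law; Camia–Newman, CMP 268 (2006), §2.2 and
MSRI 55 (2008), Thm 2: the limit is a law on closed sets of *unrooted* loops). If the percolation
loop collections `triLoopCollection D δ` converge in law (limit variable `id`) to a probability
law `P'` on `LoopSpace ℂ`, then `P'`-almost every collection `L` satisfies
`rerootSaturation L = L`: for every `η > 0` the collections at mesh `δ ≤ η/2` are
reroot-saturated up to `η` (`edist_rerootSaturation_triLoopCollection_le`), a closed condition
(`isClosed_setOf_isLoop_and_edist_rerootSaturation_le`), so by the portmanteau theorem
(`TendstoLaw.ae_mem_of_isClosed`) `edist (rerootSaturation L) L ≤ η` almost surely for every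
`η = 1/(n+1)`. [cite: CamiaNewman2006, §2.2] -/
theorem ae_rerootSaturation_eq_of_tendstoLaw {P' : Measure (LoopSpace ℂ)} [IsProbabilityMeasure P']
    (h : TendstoLaw (Ωδ := fun _ ↦ SiteConfig (Site 2)) (fun δ ↦ triLoopCollection D δ)
      (fun _ ↦ triSitePercolation half) id P') :
    ∀ᵐ L ∂P', LoopSpace.rerootSaturation L = L := by
  have key : ∀ n : ℕ, ∀ᵐ L ∂P', L ∈ {L : LoopSpace ℂ | (∀ c ∈ L, CurveClass.IsLoop c) ∧
      edist (LoopSpace.rerootSaturation L) L ≤ ENNReal.ofReal (1 / ((n : ℝ) + 1))} := by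
    intro n
    refine h.ae_mem_of_isClosed (isClosed_setOf_isLoop_and_edist_rerootSaturation_le _) ?_
    have hη : (0 : ℝ) < 1 / ((n : ℝ) + 1) / 2 := by positivity
    filter_upwards [Ioc_mem_nhdsGT hη] with δ hδ
    exact ae_of_all _ fun ω ↦
      triLoopCollection_mem_setOf_edist_rerootSaturation_le D hδ.1 hδ.2 ω
  rw [← ae_all_iff] at key
  filter_upwards [key] with L hL
  have h0 : edist (LoopSpace.rerootSaturation L) L = 0 := by
    refine le_antisymm (ENNReal.le_of_forall_pos_le_add fun ε hε _ ↦ ?_) bot_le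
    obtain ⟨n, hn⟩ := exists_nat_one_div_lt (show (0 : ℝ) < ε from hε)
    calc edist (LoopSpace.rerootSaturation L) L ≤ ENNReal.ofReal (1 / ((n : ℝ) + 1)) := (hL n).2
      _ ≤ ENNReal.ofReal ε := ENNReal.ofReal_le_ofReal hn.le
      _ = 0 + ε := by rw [ENNReal.ofReal_coe_nnreal, zero_add]
  exact edist_eq_zero.1 h0

/-- **Reduction of `exists_isCNLFamily_tendsto`, reroot-saturation discharged.** To prove the
unrooted full-scaling-limit statement of `CLE6.lean` it suffices to exhibit probability laws
`ν D` that are limits in law of the loop collections in every Jordan domain `D` and to verify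
local finiteness of traces, infinitude of non-trivial traces and conformal invariance for them:
the loop property, membership of traces in `D̄` (`CLE6Limit.lean`) and reroot-saturation
(`ae_rerootSaturation_eq_of_tendstoLaw`) hold for every limit law (Camia–Newman, MSRI 55
(2008), Thms 2–3; CMP 268 (2006), Thm 2 and §§5–6). [cite: CamiaNewman2008, Theorems 2–3] -/
theorem exists_isCNLFamily_tendsto_of_tendstoLaw' (ν : JordanDomain → Measure (LoopSpace ℂ))
    (hP : ∀ D, IsProbabilityMeasure (ν D))
    (hlim : ∀ D : JordanDomain, TendstoLaw (Ωδ := fun _ ↦ SiteConfig (Site 2))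
      (fun δ ↦ triLoopCollection D δ) (fun _ ↦ triSitePercolation half) id (ν D))
    (hfin : ∀ D, ∀ᵐ L ∂(ν D), ∀ ε : ℝ, 0 < ε →
      {s : Set ℂ | ∃ c ∈ L, CurveClass.range c = s ∧ ε < Metric.diam s}.Finite)
    (hinf : ∀ D, ∀ᵐ L ∂(ν D),
      {s : Set ℂ | ∃ c ∈ L, ¬ CurveClass.IsTrivial c ∧ CurveClass.range c = s}.Infinite)
    (hconf : ∀ (D D' : JordanDomain) (φ : ConformalEquiv D.carrier D'.carrier) (Φ : C(ℂ, ℂ)),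
      EqOn Φ φ D.carrier → MapsTo Φ (closure D.carrier) (closure D'.carrier) →
        ν D' = (ν D).map (LoopSpace.map Φ)) :
    exists_isCNLFamily_tendsto :=
  exists_isCNLFamily_tendsto_of_tendstoLaw ν hP hlim
    (fun D ↦ by haveI := hP D; exact ae_rerootSaturation_eq_of_tendstoLaw D (hlim D)) hfin hinf hconf

end Limit

end Literature.Probability.Percolation
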